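/-
# [B4] THEOREM (1.9), THE HÖLDER MEMBER, ON A BOX `Ω` — the walk route for the Hölder probe assembled, uniformly in `η`

statement-level skeleton of published theorems with citation tags; proofs where landed; nothing here is a claim about
the Yang–Mills mass gap

[B4] = Balaban, *Regularity and decay of lattice Green's functions*, Commun. Math. Phys. 89 (1983) 571–597.

THEOREM p.573 (1.9): «for α < 1 … |x−x′|^{−α}|U(A(Γ_{x,x′}))(D^η_{A,μ}G_k(Ω,A)f)(x′) − (D^η_{A,μ}G_k(Ω,A)f)(x)| ≤
c₀exp(−δ₀dist({x,x′}, supp f))‖f‖_∞».  The owner seat r01 proved the walk route for the Hölder probe abstractly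
(`B4Ineq19WalkRoute.ineq19_holder_apply`, any `σ`, any `U`, per-cube input `γ_H ≥ ‖P_H·h_jG_jh_j‖`).  THIS FILE
instantiates it on the box `Ω = Box d ℓ k Mb` with the print's scaling `σ = n·(n/r)^α` (`D^η = n·`bond difference,
`r = |x′−x|_∞` in fine units), `U = U(A(Γ))` the transport along a nearest-neighbour chain `Γ` from `x` to `x′` inside the
ball of radius `r`, for an ARBITRARY configuration `A` and antisymmetric cube configurations `Ã_j` agreeing with `A` on the
plateaus, the per-cube inputs in the lineage's `supN` forms (value `c_G`, derivatives `c_D`, Hölder `c_H` — the latter in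
the exact form of p35's `B4Lemma22HolderCubeField.lemma22_holder_cubeField` —, (2.20) `c_K`), the input `γ_H` being
`B4HolderLetterBox.holder_letter_box` (UNIFORM IN `η`).

MAIN THEOREM `thm19_holder_box`: for `x ≠ x′` with `32|x′−x|_∞ ≤ nK` (pairs farther apart are covered by the derivative
member), `x+e_μ, x′+e_μ ∈ Ω`, `f` supported at unit-lattice sup-distance `≥ D` from `x`:
`(n/r)^α·|U(A(Γ))(D^η_{A,μ}G_k(Ω,A)f)(x′) − (D^η_{A,μ}G_k(Ω,A)f)(x)| ≤ 2^{d+4}e^{5/2}·γ_H·e^{−D/K}·‖f‖_∞` with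
`γ_H = √N(c_H + (d+1)D1c_D + (d+3)s c_D + (d+1)(D1²+D2)c_G)`.

HONEST SCOPE.  Boxes; `0 ≤ α ≤ 1` is free here (the inputs carry it); `16 ≤ K`, `K ∣ Mb_μ`; the chain is a hypothesis
(any nearest-neighbour chain of length `≤ (d+1)r` inside the `r`-ball); inputs are hypotheses (discharged for a regular
field constant near `∂Ω` in the sequel).  No `def`, no `Prop` fact, no `sorry`; axioms standard.
-/
import Literature.MathematicalPhysics.QuantumFieldTheory.Balaban1983to89.B4HolderLetterBox

namespace Literature.MathematicalPhysics.QuantumFieldTheory.Balaban1983to89.B4Thm19BoxHolderWalk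

open Literature.MathematicalPhysics.QuantumFieldTheory.Balaban1983to89.B4Reflection242 (boxDom mem_boxDom nbrs mem_nbrs)
open Literature.MathematicalPhysics.QuantumFieldTheory.Balaban1983to89.B4GaugeCovariance
open Literature.MathematicalPhysics.QuantumFieldTheory.Balaban1983to89.B4Commutators25to211 (mulH opK)
open Literature.MathematicalPhysics.QuantumFieldTheory.Balaban1983to89.B4Lower18Regular (e1 e1_apply_self e1_apply_ne
  lsum baseEmb stairContour transport_fieldLink)
open Literature.MathematicalPhysics.QuantumFieldTheory.Balaban1983to89.B4Lemma21Region (siteNorm covDeriv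
  fld_covDeriv_mulVec_of_mem)
open Literature.MathematicalPhysics.QuantumFieldTheory.Balaban1983to89.B4Lemma22ReduceZero (Box opA greenA derivA)
open Literature.MathematicalPhysics.QuantumFieldTheory.Balaban1983to89.B4Lemma22Reduce231 (supN supN_nonneg)
open Literature.MathematicalPhysics.QuantumFieldTheory.Balaban1983to89.B4Lemma22Invertible (opA_stair_isUnit_det)
open Literature.MathematicalPhysics.QuantumFieldTheory.Balaban1983to89.B4PartitionUnity22 (hCube hCube_ne_zero_imp hprof
  D1 D2 D1_nonneg D2_nonneg contDiff_hprof hasCompactSupport_hprof)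
open Literature.MathematicalPhysics.QuantumFieldTheory.Balaban1983to89.B4ContourShift (supNorm abs_le_supNorm
  supNorm_nonneg)
open Literature.MathematicalPhysics.QuantumFieldTheory.Balaban1983to89.B4Eq220PartitionSizes (hBox)
open Literature.MathematicalPhysics.QuantumFieldTheory.Balaban1983to89.B4Eq220CommutatorField (kOp)
open Literature.MathematicalPhysics.QuantumFieldTheory.Balaban1983to89.B4Lemma22HolderBox (IsNNChain)
open Literature.MathematicalPhysics.QuantumFieldTheory.Balaban1983to89.B4Ineq19WalkRoute (ineq19_holder_apply
  holderOp_mul_mulH)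
open Literature.MathematicalPhysics.QuantumFieldTheory.Balaban1983to89.B4CubeOpReindex (linfty_opNorm_le_of_supN)
open Literature.MathematicalPhysics.QuantumFieldTheory.Balaban1983to89.B4BoxCubeGeometry
open Literature.MathematicalPhysics.QuantumFieldTheory.Balaban1983to89.B4HolderChainTools (one_le_supNorm_of_ne)
open Literature.MathematicalPhysics.QuantumFieldTheory.Balaban1983to89.B4HolderLetterBox (holder_letter_box)
open Literature.MathematicalPhysics.QuantumFieldTheory.Balaban1983to89.B4Lower18RegularRegion (compField)
open Literature.MathematicalPhysics.QuantumFieldTheory.Balaban1983to89.B4CubeFields22 (cubeField cubeField_antisymm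
  cubeField_eq_compField)
open Literature.MathematicalPhysics.QuantumFieldTheory.Balaban1983to89.B4Thm110BoxWalk (plateau_fine)
open scoped Matrix
open scoped Matrix.Norms.Operator

noncomputable section

variable {d : ℕ}
variable {ι : Type} [Fintype ι] [DecidableEq ι]

/-! ## 1. Positions, the chain and the plateau -/

omit [Fintype ι] [DecidableEq ι] in
/-- bond sums along a path inside a set `P` agree for configurations agreeing on `P`-pairs. [cite: Balaban1983RegularityDecay, (1.4) p.572, dictionary] -/
theorem lsum_congr_of_forall {X : Type*} {B B' : X → X → ℝ} {P : X → Prop}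
    (h : ∀ u v, P u → P v → B u v = B' u v) :
    ∀ (x : X) (l : List X), P x → (∀ z ∈ l, P z) → lsum B x l = lsum B' x l
  | _, [], _, _ => rfl
  | x, y :: l, hx, hl => by
      have hy : P y := hl y (by simp)
      rw [lsum, lsum, h x y hx hy, lsum_congr_of_forall h y l hy fun z hz => hl z (by simp [hz])]

omit [Fintype ι] [DecidableEq ι] in
/-- positions of fine sites at integer sup-distance `≤ R` are at distance `≤ R/n` in unit-lattice coordinates.
[cite: Balaban1983RegularityDecay, (1.9) p.573 «|x − x′|», dictionary] -/
theorem abs_posR_sub_le {ℓ k : ℕ} {Mb : Fin (d + 1) → ℕ} {p q : ↥(Box d ℓ k Mb)} {R : ℝ}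
    (h : ∀ ν, |((q.1 ν : ℤ) : ℝ) - p.1 ν| ≤ R) (ν : Fin (d + 1)) :
    |posR ℓ k Mb q ν - posR ℓ k Mb p ν| ≤ R / (((ℓ + 1) ^ k : ℕ) : ℝ) := by
  have hn : (0 : ℝ) < (((ℓ + 1) ^ k : ℕ) : ℝ) := by exact_mod_cast pow_pos (Nat.succ_pos ℓ) k
  rw [posR, posR, ← sub_div, abs_div, abs_of_pos hn]
  exact div_le_div_of_nonneg_right (h ν) hn.le

omit [Fintype ι] [DecidableEq ι] in
/-- coordinates of `x + e_μ − x` are `≤ 1` in absolute value. [folklore] -/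
private theorem abs_e1_cast_le (μ ν : Fin (d + 1)) : |((e1 μ ν : ℤ) : ℝ)| ≤ 1 := by
  by_cases h : ν = μ
  · subst h; rw [e1_apply_self]; simp
  · rw [e1_apply_ne h]; simp

/-! ## 2. THEOREM (1.9), the Hölder member, on a box -/

/-- **THEOREM (1.9) ON A BOX `Ω`, THE HÖLDER MEMBER — THE WALK ROUTE FOR THE HÖLDER PROBE ASSEMBLED, UNIFORMLY IN `η`.**
Data as in `B4Thm110BoxDerivWalk.thm110_deriv_box` (box, `16 ≤ K`, `4 ∣ K`, `K ∣ Mb_μ`, arbitrary `A`, antisymmetric cube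
configurations `Ã_j` agreeing with `A` on the plateaus) and, for every label `j`, the inputs `‖G_k(Ω,Ã_j)Φ‖_∞ ≤ c_G‖Φ‖_∞`,
`‖D^η_{Ã_j,ν}G_k(Ω,Ã_j)Φ‖_∞ ≤ c_D‖Φ‖_∞` (all `ν`), the Hölder bound
`(n/r)^α|U(Ã_j(Γ))(D^η_{Ã_j,μ}G_k(Ω,Ã_j)Φ)(x′) − (D^η_{Ã_j,μ}G_k(Ω,Ã_j)Φ)(x)| ≤ c_H‖Φ‖_∞` for the pair and chain at hand,
`‖K_{h_j}G_k(Ω,Ã_j)h_jΦ‖_∞ ≤ c_K‖Φ‖_∞`, `3^{d+1}√N c_K ≤ e^{−1}`.  Then for `x ≠ x′`, `32|x′−x|_∞ ≤ nK`, `x+e_μ, x′+e_μ ∈ Ω`,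
a nearest-neighbour chain `Γ` from `x` to `x′` of length `≤ (d+1)|x′−x|_∞` inside the ball of radius `|x′−x|_∞` about `x`,
and `f` supported in `P` at unit-lattice sup-distance `≥ D` from `x` with `|f| ≤ φ`:
`(n/r)^α·|U(A(Γ))(D^η_{A,μ}G_k(Ω,A)f)(x′) − (D^η_{A,μ}G_k(Ω,A)f)(x)| ≤ 2^{d+4}e^{5/2}γ_H e^{−D/K}φ`,
`γ_H = √N(c_H + (d+1)D1c_D + (d+3)s c_D + (d+1)(D1²+D2)c_G)`.
[cite: Balaban1983RegularityDecay, Theorem (1.9) p.573; (2.14), (2.18) pp.577–578, (2.3)–(2.4) p.575] -/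
theorem thm19_holder_box (F : OrthFlow ι) (κ : ℝ) {ℓ k : ℕ} (hℓ : 1 ≤ ℓ) (hk : 1 ≤ k) (hn : 1 ≤ (ℓ + 1) ^ k)
    (Mb : Fin (d + 1) → ℕ) {K : ℕ} (hK16 : 16 ≤ K) (h4 : 4 ∣ K) (hKM : ∀ ν, K ∣ Mb ν) {a m2 : ℝ} (ha : 0 < a)
    (hm : 0 ≤ m2) (A : ↥(Box d ℓ k Mb) → ↥(Box d ℓ k Mb) → ℝ)
    (Ac : (Fin (d + 1) → ℤ) → ↥(Box d ℓ k Mb) → ↥(Box d ℓ k Mb) → ℝ) (hanti : ∀ j u v, Ac j v u = -Ac j u v)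
    (hplat : ∀ j (u v : ↥(Box d ℓ k Mb)), (∀ ν, |posR ℓ k Mb u ν - (K : ℝ) * j ν| ≤ 3 / 4 * (K : ℝ)) →
      (∀ ν, |posR ℓ k Mb v ν - (K : ℝ) * j ν| ≤ 3 / 4 * (K : ℝ)) → Ac j u v = A u v)
    {cG cD cH cK : ℝ} (hcG : 0 ≤ cG) (hcD : 0 ≤ cD) (hcH : 0 ≤ cH) (hcK : 0 ≤ cK)
    (hG : ∀ j ∈ labels Mb, ∀ Φ : ↥(Box d ℓ k Mb) × ι → ℝ,
      supN (greenA d F κ ℓ k a m2 Mb (baseEmb hn Mb) (stairContour hn Mb) (Ac j) *ᵥ Φ) ≤ cG * supN Φ)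
    (hDG : ∀ j ∈ labels Mb, ∀ (ν : Fin (d + 1)) (Φ : ↥(Box d ℓ k Mb) × ι → ℝ),
      supN (derivA d F κ ℓ k Mb (Ac j) ν
        *ᵥ (greenA d F κ ℓ k a m2 Mb (baseEmb hn Mb) (stairContour hn Mb) (Ac j) *ᵥ Φ)) ≤ cD * supN Φ)
    (hKG : ∀ j ∈ labels Mb, ∀ Φ : ↥(Box d ℓ k Mb) × ι → ℝ,
      supN (kOp F κ ((ℓ + 1) ^ k) (B1.aSeq a ((ℓ : ℝ) + 1) k) m2 Mb (baseEmb hn Mb) (stairContour hn Mb) (Ac j)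
            (hBox ((ℓ + 1) ^ k) K Mb j)
          *ᵥ (greenA d F κ ℓ k a m2 Mb (baseEmb hn Mb) (stairContour hn Mb) (Ac j)
            *ᵥ (mulH (ι := ι) (hBox ((ℓ + 1) ^ k) K Mb j) *ᵥ Φ))) ≤ cK * supN Φ)
    (h3 : (3 : ℝ) ^ (d + 1) * (Real.sqrt (Fintype.card ι) * cK) ≤ Real.exp (-1))
    -- the pair, the bonds, the chain, the Hölder weight
    (μ : Fin (d + 1)) (x x' : ↥(Box d ℓ k Mb)) (hxμ : x.1 + e1 μ ∈ Box d ℓ k Mb) (hx'μ : x'.1 + e1 μ ∈ Box d ℓ k Mb)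
    (hne : x'.1 ≠ x.1) (hclose : 32 * supNorm (x'.1 - x.1) ≤ (((ℓ + 1) ^ k : ℕ) : ℝ) * K)
    (l : List ↥(Box d ℓ k Mb)) (hl : IsNNChain x l) (hlend : pathEnd x l = x')
    (hlen : (l.length : ℝ) ≤ ((d : ℝ) + 1) * supNorm (x'.1 - x.1))
    (hlnear : ∀ z ∈ l, supNorm (z.1 - x.1) ≤ supNorm (x'.1 - x.1)) {α : ℝ} (hα0 : 0 ≤ α) (hα1 : α ≤ 1)
    (hHG : ∀ j ∈ labels Mb, ∀ Φ : ↥(Box d ℓ k Mb) × ι → ℝ,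
      ((((ℓ + 1) ^ k : ℕ) : ℝ) / supNorm (x'.1 - x.1)) ^ α *
        siteNorm (transport (fieldLink F κ (Ac j)) x l
            *ᵥ fld (derivA d F κ ℓ k Mb (Ac j) μ
                  *ᵥ (greenA d F κ ℓ k a m2 Mb (baseEmb hn Mb) (stairContour hn Mb) (Ac j) *ᵥ Φ)) x'
          - fld (derivA d F κ ℓ k Mb (Ac j) μ
                  *ᵥ (greenA d F κ ℓ k a m2 Mb (baseEmb hn Mb) (stairContour hn Mb) (Ac j) *ᵥ Φ)) x)
        ≤ cH * supN Φ)
    -- the source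
    (P : ↥(Box d ℓ k Mb) → Prop) [DecidablePred P] {D : ℝ}
    (hD : ∀ x'', P x'' → ∃ ν, D ≤ |posR ℓ k Mb x ν - posR ℓ k Mb x'' ν|)
    (f : ↥(Box d ℓ k Mb) × ι → ℝ) (hfP : ∀ p, ¬ P p.1 → f p = 0) {φ : ℝ} (hφ : 0 ≤ φ) (hf : ∀ p, |f p| ≤ φ)
    (i0 : ι) :
    ((((ℓ + 1) ^ k : ℕ) : ℝ) / supNorm (x'.1 - x.1)) ^ α *
      |(transport (fieldLink F κ A) x l
          *ᵥ fld (derivA d F κ ℓ k Mb A μ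
                *ᵥ (greenA d F κ ℓ k a m2 Mb (baseEmb hn Mb) (stairContour hn Mb) A *ᵥ f)) x'
        - fld (derivA d F κ ℓ k Mb A μ
                *ᵥ (greenA d F κ ℓ k a m2 Mb (baseEmb hn Mb) (stairContour hn Mb) A *ᵥ f)) x) i0|
      ≤ 2 ^ (d + 4) * Real.exp (5 / 2)
          * (Real.sqrt (Fintype.card ι) * (cH + ((d : ℝ) + 1) * D1 hprof * cD
              + ((d : ℝ) + 3) * (((d : ℝ) + 1) * (D1 hprof + D2 hprof)) * cD
              + ((d : ℝ) + 1) * (D1 hprof ^ 2 + D2 hprof) * cG))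
          * Real.exp (-(D / K)) * φ := by
  classical
  -- scalars
  have hK8 : 8 ≤ K := le_trans (by norm_num) hK16
  have hK1 : 1 ≤ K := le_trans (by norm_num) hK16
  have hKr : (0 : ℝ) < K := by exact_mod_cast hK1
  have hK16r : (16 : ℝ) ≤ K := by exact_mod_cast hK16
  have hn2 : 2 ≤ (ℓ + 1) ^ k := by
    calc 2 ≤ ℓ + 1 := by omega
      _ = (ℓ + 1) ^ 1 := (pow_one _).symm
      _ ≤ (ℓ + 1) ^ k := Nat.pow_le_pow_right (Nat.succ_pos ℓ) hk
  set nr : ℝ := (((ℓ + 1) ^ k : ℕ) : ℝ) with hnr_def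
  have hnr : (0 : ℝ) < nr := by rw [hnr_def]; exact_mod_cast hn
  have hnr2 : (2 : ℝ) ≤ nr := by rw [hnr_def]; exact_mod_cast hn2
  have hnK : 3 ≤ (ℓ + 1) ^ k * K := by nlinarith
  have hnK32 : (32 : ℝ) ≤ nr * K := by nlinarith
  set r : ℝ := supNorm (x'.1 - x.1) with hr_def
  have hr1 : 1 ≤ r := one_le_supNorm_of_ne hne
  have hr0 : 0 ≤ r := by linarith
  have hrK : r ≤ nr * K := by linarith
  set w : ℝ := (nr / r) ^ α with hw_def
  have hw0 : 0 ≤ w := Real.rpow_nonneg (div_nonneg hnr.le hr0) α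
  have hD1 := D1_nonneg contDiff_hprof hasCompactSupport_hprof
  have hD2 := D2_nonneg contDiff_hprof hasCompactSupport_hprof
  -- the bond end points and the probe data
  set y : ↥(Box d ℓ k Mb) := ⟨x.1 + e1 μ, hxμ⟩ with hy
  set y' : ↥(Box d ℓ k Mb) := ⟨x'.1 + e1 μ, hx'μ⟩ with hy'
  set W : ↥(Box d ℓ k Mb) → ↥(Box d ℓ k Mb) → Matrix ι ι ℝ := fieldLink F κ A with hW
  set U : Matrix ι ι ℝ := transport W x l with hU
  set Gr : (Fin (d + 1) → ℤ) → Matrix (↥(Box d ℓ k Mb) × ι) (↥(Box d ℓ k Mb) × ι) ℝ :=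
    fun j => greenA d F κ ℓ k a m2 Mb (baseEmb hn Mb) (stairContour hn Mb) (Ac j) with hGr
  set hh : (Fin (d + 1) → ℤ) → ↥(Box d ℓ k Mb) → ℝ := fun j z => hCube (K : ℝ) j (posR ℓ k Mb z) with hhh
  -- integer distances to `x`: every relevant point is within `r + 1`
  have dx : ∀ ν, |((x.1 ν : ℤ) : ℝ) - x.1 ν| ≤ r + 1 := fun ν => by rw [sub_self, abs_zero]; linarith
  have dy : ∀ ν, |((y.1 ν : ℤ) : ℝ) - x.1 ν| ≤ r + 1 := fun ν => by
    rw [hy]; simp only [Pi.add_apply, Int.cast_add, add_sub_cancel_left]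
    exact (abs_e1_cast_le μ ν).trans (by linarith)
  have dx' : ∀ ν, |((x'.1 ν : ℤ) : ℝ) - x.1 ν| ≤ r + 1 := fun ν => by
    have h := abs_le_supNorm (x'.1 - x.1) ν
    rw [Pi.sub_apply, Int.cast_abs, Int.cast_sub] at h
    exact h.trans (by linarith)
  have dy' : ∀ ν, |((y'.1 ν : ℤ) : ℝ) - x.1 ν| ≤ r + 1 := fun ν => by
    rw [hy']; simp only [Pi.add_apply, Int.cast_add]
    have h := abs_le_supNorm (x'.1 - x.1) ν
    rw [Pi.sub_apply, Int.cast_abs, Int.cast_sub] at h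
    calc |((x'.1 ν : ℤ) : ℝ) + ((e1 μ ν : ℤ) : ℝ) - x.1 ν| = |(((x'.1 ν : ℤ) : ℝ) - x.1 ν) + ((e1 μ ν : ℤ) : ℝ)| := by
          ring_nf
      _ ≤ |((x'.1 ν : ℤ) : ℝ) - x.1 ν| + |((e1 μ ν : ℤ) : ℝ)| := abs_add_le _ _
      _ ≤ r + 1 := add_le_add h (abs_e1_cast_le μ ν)
  have dl : ∀ z ∈ l, ∀ ν, |((z.1 ν : ℤ) : ℝ) - x.1 ν| ≤ r + 1 := fun z hz ν => by
    have h := abs_le_supNorm (z.1 - x.1) ν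
    rw [Pi.sub_apply, Int.cast_abs, Int.cast_sub] at h
    exact h.trans ((hlnear z hz).trans (by linarith))
  -- unit-lattice distances: `(2r+2)/n ≤ K/8`
  have hclose' : (2 * r + 2) / nr ≤ 1 / 8 * (K : ℝ) := by
    rw [div_le_iff₀ hnr]; nlinarith
  have hpair : ∀ (p q : ↥(Box d ℓ k Mb)), (∀ ν, |((p.1 ν : ℤ) : ℝ) - x.1 ν| ≤ r + 1) →
      (∀ ν, |((q.1 ν : ℤ) : ℝ) - x.1 ν| ≤ r + 1) → ∀ ν, |posR ℓ k Mb q ν - posR ℓ k Mb p ν| ≤ 1 / 8 * (K : ℝ) := by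
    intro p q hp hq ν
    have h2 : ∀ ν, |((q.1 ν : ℤ) : ℝ) - p.1 ν| ≤ 2 * r + 2 := fun ν => by
      calc |((q.1 ν : ℤ) : ℝ) - p.1 ν| = |(((q.1 ν : ℤ) : ℝ) - x.1 ν) - (((p.1 ν : ℤ) : ℝ) - x.1 ν)| := by ring_nf
        _ ≤ |((q.1 ν : ℤ) : ℝ) - x.1 ν| + |((p.1 ν : ℤ) : ℝ) - x.1 ν| := abs_sub _ _
        _ ≤ 2 * r + 2 := by linarith [hp ν, hq ν]
    exact (abs_posR_sub_le h2 ν).trans hclose'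
  have hxy : ∀ ν, |posR ℓ k Mb x ν - posR ℓ k Mb y ν| ≤ 1 / 8 * (K : ℝ) := hpair y x dy dx
  have hxx' : ∀ ν, |posR ℓ k Mb x ν - posR ℓ k Mb x' ν| ≤ 1 / 8 * (K : ℝ) := hpair x' x dx' dx
  have hx'y' : ∀ ν, |posR ℓ k Mb x' ν - posR ℓ k Mb y' ν| ≤ 1 / 8 * (K : ℝ) := hpair y' x' dy' dx'
  -- the per-cube Hölder input
  set γH : ℝ := Real.sqrt (Fintype.card ι) * (cH + ((d : ℝ) + 1) * D1 hprof * cD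
      + ((d : ℝ) + 3) * (((d : ℝ) + 1) * (D1 hprof + D2 hprof)) * cD
      + ((d : ℝ) + 1) * (D1 hprof ^ 2 + D2 hprof) * cG) with hγH_def
  have hγH0 : 0 ≤ γH := by rw [hγH_def]; positivity
  have hγH : ∀ j : ↥(labels Mb),
      ‖(nr * w) • (unitOp x y' (U * W x' y') - unitOp x x' U - (unitOp x y (W x y) - unitOp x x 1))
        * (mulH (ι := ι) (hh j.1) * Gr j.1 * mulH (ι := ι) (hh j.1))‖ ≤ γH := by
    intro j
    by_cases hzero : hh j.1 x = 0 ∧ hh j.1 y = 0 ∧ hh j.1 x' = 0 ∧ hh j.1 y' = 0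
    · -- the probe does not see `h_j`: the letter vanishes
      obtain ⟨h1, h2, h3', h4'⟩ := hzero
      rw [← Matrix.mul_assoc, ← Matrix.mul_assoc, holderOp_mul_mulH, h1, h2, h3', h4']
      simp only [zero_smul, sub_self, smul_zero, Matrix.zero_mul, norm_zero]
      exact hγH0
    · -- some of the four points is seen by `h_j`: everything is in the plateau of `□_j`
      have hseen : ∃ p : ↥(Box d ℓ k Mb), hh j.1 p ≠ 0 ∧ ∀ ν, |((p.1 ν : ℤ) : ℝ) - x.1 ν| ≤ r + 1 := by
        by_cases a1 : hh j.1 x = 0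
        · by_cases a2 : hh j.1 y = 0
          · by_cases a3 : hh j.1 x' = 0
            · have a4 : hh j.1 y' ≠ 0 := fun a4 => hzero ⟨a1, a2, a3, a4⟩
              exact ⟨y', a4, dy'⟩
            · exact ⟨x', a3, dx'⟩
          · exact ⟨y, a2, dy⟩
        · exact ⟨x, a1, dx⟩
      obtain ⟨p, hp, dp⟩ := hseen
      have hpl : ∀ q : ↥(Box d ℓ k Mb), (∀ ν, |((q.1 ν : ℤ) : ℝ) - x.1 ν| ≤ r + 1) →
          ∀ ν, |posR ℓ k Mb q ν - (K : ℝ) * j.1 ν| ≤ 3 / 4 * (K : ℝ) := by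
        intro q hq ν
        have h1 := hCube_ne_zero_imp hKr hp ν
        have h2 := hpair p q dp hq ν
        calc |posR ℓ k Mb q ν - (K : ℝ) * j.1 ν|
            ≤ |posR ℓ k Mb q ν - posR ℓ k Mb p ν| + |posR ℓ k Mb p ν - (K : ℝ) * j.1 ν| := abs_sub_le _ _ _
          _ ≤ 1 / 8 * (K : ℝ) + 5 / 8 * (K : ℝ) := add_le_add h2 h1.le
          _ = 3 / 4 * (K : ℝ) := by ring
      -- the configuration `A` agrees with `Ã_j` on the relevant bonds
      have hWxy : W x y = fieldLink F κ (Ac j.1) x y := by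
        rw [hW]; show F.U (κ * A x y) = F.U (κ * Ac j.1 x y)
        rw [hplat j.1 x y (hpl x dx) (hpl y dy)]
      have hWx'y' : W x' y' = fieldLink F κ (Ac j.1) x' y' := by
        rw [hW]; show F.U (κ * A x' y') = F.U (κ * Ac j.1 x' y')
        rw [hplat j.1 x' y' (hpl x' dx') (hpl y' dy')]
      have hUeq : U = transport (fieldLink F κ (Ac j.1)) x l := by
        rw [hU, hW, transport_fieldLink, transport_fieldLink,
          lsum_congr_of_forall (P := fun z : ↥(Box d ℓ k Mb) => ∀ ν, |posR ℓ k Mb z ν - (K : ℝ) * j.1 ν| ≤ 3 / 4 * (K : ℝ))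
            (fun u v hu hv => (hplat j.1 u v hu hv).symm) x l (hpl x dx) (fun z hz => hpl z (dl z hz))]
      rw [hWxy, hWx'y', hUeq]
      exact holder_letter_box F κ hn hK1 hnK hKM (Ac j.1) (hanti j.1) (Gr j.1) j.1 hcG hcD hcH (hG j.1 j.2)
        (hDG j.1 j.2) μ x x' hxμ hx'μ hne hrK l hl hlend hlen hα0 hα1 (hHG j.1 j.2)
  -- the walk route for the Hölder probe
  have main := ineq19_holder_apply (X := ↥(Box d ℓ k Mb)) (Y := ↥(boxDom Mb)) (κ := ι) hKr (posR ℓ k Mb)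
    (boxWt ((ℓ + 1) ^ k) (fun i => (ℓ + 1) ^ k * Mb i)) m2
    (B1.aSeq a ((ℓ : ℝ) + 1) k * (((((ℓ + 1) ^ k : ℕ)) : ℝ) ^ (d + 1))⁻¹)
    (blkWt ((ℓ + 1) ^ k) Mb (fun i => (ℓ + 1) ^ k * Mb i)) W
    (contourTrans (fieldLink F κ A) (baseEmb hn Mb) (stairContour hn Mb))
    (fun _ _ h => boxWt_local hK8 h) (fun _ _ _ h h' => blkWt_local hK8 h h')
    (labels Mb) (fun j z h => mem_labels_of_hCube_ne_zero hK1 j z h)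
    (fun _ _ => True) (fun _ _ _ => trivial)
    (fun j => fieldLink F κ (Ac j))
    (fun j => contourTrans (fieldLink F κ (Ac j)) (baseEmb hn Mb) (stairContour hn Mb))
    (fun j u v hu hv => by
      show F.U (κ * Ac j u v) = F.U (κ * A u v)
      rw [hplat j u v hu hv])
    (fun j y'' u hq hu => contourTrans_plateau F κ h4 hn (hplat j) hu hq)
    Gr
    (fun j _ => by
      simp only [iff_self, if_true]
      exact Matrix.mul_nonsing_inv _ (opA_stair_isUnit_det F κ hℓ hk hn ha hm Mb (Ac j)))
    (greenA d F κ ℓ k a m2 Mb (baseEmb hn Mb) (stairContour hn Mb) A)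
    (Matrix.nonsing_inv_mul _ (opA_stair_isUnit_det F κ hℓ hk hn ha hm Mb A))
    x y x' y' hxy hxx' hx'y' (nr * w) U (β := Real.sqrt (Fintype.card ι) * cK) hγH0 hγH (by positivity)
    (fun j => by
      simp only [iff_self, if_true]
      refine linfty_opNorm_le_of_supN _ hcK fun Φ => ?_
      rw [← Matrix.mulVec_mulVec, ← Matrix.mulVec_mulVec]
      exact hKG j.1 j.2 Φ)
    h3 P hD f hfP hφ hf i0
  -- identify the probe's value with the Hölder quotient of `D^η_{A,μ}G f`
  set Ψ := greenA d F κ ℓ k a m2 Mb (baseEmb hn Mb) (stairContour hn Mb) A *ᵥ f with hΨ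
  have hderiv : ∀ (u : ↥(Box d ℓ k Mb)) (hu : u.1 + e1 μ ∈ Box d ℓ k Mb),
      W u ⟨u.1 + e1 μ, hu⟩ *ᵥ fld Ψ ⟨u.1 + e1 μ, hu⟩ - fld Ψ u = nr⁻¹ • fld (derivA d F κ ℓ k Mb A μ *ᵥ Ψ) u := by
    intro u hu
    rw [show derivA d F κ ℓ k Mb A μ = covDeriv ((ℓ + 1) ^ k) (Box d ℓ k Mb) (fieldLink F κ A) μ from rfl,
      fld_covDeriv_mulVec_of_mem ((ℓ + 1) ^ k) (fieldLink F κ A) Ψ hu, smul_smul, hnr_def,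
      inv_mul_cancel₀ hnr.ne', one_smul]
  have hid : (nr * w) • (U *ᵥ (W x' y' *ᵥ fld Ψ y' - fld Ψ x') - (W x y *ᵥ fld Ψ y - fld Ψ x))
      = w • (U *ᵥ fld (derivA d F κ ℓ k Mb A μ *ᵥ Ψ) x' - fld (derivA d F κ ℓ k Mb A μ *ᵥ Ψ) x) := by
    rw [hy, hy', hderiv x' hx'μ, hderiv x hxμ, Matrix.mulVec_smul, ← smul_sub, smul_smul,
      show nr * w * nr⁻¹ = w by field_simp]
  rw [hid] at main
  rw [Pi.smul_apply, smul_eq_mul, abs_mul, abs_of_nonneg hw0] at main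
  refine main.trans (le_of_eq ?_)
  ring

/-! ## 3. The print's cube configurations `Ã_j` -/

/-- **THEOREM (1.9), HÖLDER MEMBER, ON A BOX FOR `A = compField Ac` AND THE PRINT'S `Ã_j = A₀ + θ_j(A − A₀)`**
(`B4CubeFields22.cubeField`, antisymmetric by `cubeField_antisymm`, agreeing with `A` on the plateaus by p35's
`cubeField_eq_compField`): the remaining inputs are in the exact output forms of `B4Eq220CubeField.lemma22_sup_cubeField`
(.1, .2), `eq220_cubeField` and `B4Lemma22HolderCubeField.lemma22_holder_cubeField` at the interior cubes.
[cite: Balaban1983RegularityDecay, Theorem (1.9) p.573; §2 pp.575–579] -/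
theorem thm19_holder_box_cubeField (F : OrthFlow ι) {ℓ k : ℕ} (hℓ : 1 ≤ ℓ) (hk : 1 ≤ k) (hn : 1 ≤ (ℓ + 1) ^ k)
    (Mb : Fin (d + 1) → ℕ) {K : ℕ} (hK16 : 16 ≤ K) (h4 : 4 ∣ K) (hKM : ∀ ν, K ∣ Mb ν) {a m2 : ℝ} (ha : 0 < a)
    (hm : 0 ≤ m2) (e : ℝ) (Ac : (Fin (d + 1) → ℤ) → Fin (d + 1) → ℝ) {cG cD cH cK : ℝ} (hcG : 0 ≤ cG)
    (hcD : 0 ≤ cD) (hcH : 0 ≤ cH) (hcK : 0 ≤ cK)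
    (hG : ∀ j ∈ labels Mb, ∀ Φ : ↥(Box d ℓ k Mb) × ι → ℝ,
      supN (greenA d F (e / ((ℓ + 1) ^ k : ℕ)) ℓ k a m2 Mb (baseEmb hn Mb) (stairContour hn Mb)
          (cubeField (Box d ℓ k Mb) ((ℓ + 1) ^ k) K j (Ac 0) Ac) *ᵥ Φ) ≤ cG * supN Φ)
    (hDG : ∀ j ∈ labels Mb, ∀ (ν : Fin (d + 1)) (Φ : ↥(Box d ℓ k Mb) × ι → ℝ),
      supN (derivA d F (e / ((ℓ + 1) ^ k : ℕ)) ℓ k Mb (cubeField (Box d ℓ k Mb) ((ℓ + 1) ^ k) K j (Ac 0) Ac) ν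
        *ᵥ (greenA d F (e / ((ℓ + 1) ^ k : ℕ)) ℓ k a m2 Mb (baseEmb hn Mb) (stairContour hn Mb)
            (cubeField (Box d ℓ k Mb) ((ℓ + 1) ^ k) K j (Ac 0) Ac) *ᵥ Φ)) ≤ cD * supN Φ)
    (hKG : ∀ j ∈ labels Mb, ∀ Φ : ↥(Box d ℓ k Mb) × ι → ℝ,
      supN (kOp F (e / ((ℓ + 1) ^ k : ℕ)) ((ℓ + 1) ^ k) (B1.aSeq a ((ℓ : ℝ) + 1) k) m2 Mb (baseEmb hn Mb)
            (stairContour hn Mb) (cubeField (Box d ℓ k Mb) ((ℓ + 1) ^ k) K j (Ac 0) Ac) (hBox ((ℓ + 1) ^ k) K Mb j)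
          *ᵥ (greenA d F (e / ((ℓ + 1) ^ k : ℕ)) ℓ k a m2 Mb (baseEmb hn Mb) (stairContour hn Mb)
              (cubeField (Box d ℓ k Mb) ((ℓ + 1) ^ k) K j (Ac 0) Ac)
            *ᵥ (mulH (ι := ι) (hBox ((ℓ + 1) ^ k) K Mb j) *ᵥ Φ))) ≤ cK * supN Φ)
    (h3 : (3 : ℝ) ^ (d + 1) * (Real.sqrt (Fintype.card ι) * cK) ≤ Real.exp (-1))
    (μ : Fin (d + 1)) (x x' : ↥(Box d ℓ k Mb)) (hxμ : x.1 + e1 μ ∈ Box d ℓ k Mb) (hx'μ : x'.1 + e1 μ ∈ Box d ℓ k Mb)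
    (hne : x'.1 ≠ x.1) (hclose : 32 * supNorm (x'.1 - x.1) ≤ (((ℓ + 1) ^ k : ℕ) : ℝ) * K)
    (l : List ↥(Box d ℓ k Mb)) (hl : IsNNChain x l) (hlend : pathEnd x l = x')
    (hlen : (l.length : ℝ) ≤ ((d : ℝ) + 1) * supNorm (x'.1 - x.1))
    (hlnear : ∀ z ∈ l, supNorm (z.1 - x.1) ≤ supNorm (x'.1 - x.1)) {α : ℝ} (hα0 : 0 ≤ α) (hα1 : α ≤ 1)
    (hHG : ∀ j ∈ labels Mb, ∀ Φ : ↥(Box d ℓ k Mb) × ι → ℝ,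
      ((((ℓ + 1) ^ k : ℕ) : ℝ) / supNorm (x'.1 - x.1)) ^ α *
        siteNorm (transport (fieldLink F (e / ((ℓ + 1) ^ k : ℕ))
              (cubeField (Box d ℓ k Mb) ((ℓ + 1) ^ k) K j (Ac 0) Ac)) x l
            *ᵥ fld (derivA d F (e / ((ℓ + 1) ^ k : ℕ)) ℓ k Mb (cubeField (Box d ℓ k Mb) ((ℓ + 1) ^ k) K j (Ac 0) Ac) μ
                  *ᵥ (greenA d F (e / ((ℓ + 1) ^ k : ℕ)) ℓ k a m2 Mb (baseEmb hn Mb) (stairContour hn Mb)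
                      (cubeField (Box d ℓ k Mb) ((ℓ + 1) ^ k) K j (Ac 0) Ac) *ᵥ Φ)) x'
          - fld (derivA d F (e / ((ℓ + 1) ^ k : ℕ)) ℓ k Mb (cubeField (Box d ℓ k Mb) ((ℓ + 1) ^ k) K j (Ac 0) Ac) μ
                  *ᵥ (greenA d F (e / ((ℓ + 1) ^ k : ℕ)) ℓ k a m2 Mb (baseEmb hn Mb) (stairContour hn Mb)
                      (cubeField (Box d ℓ k Mb) ((ℓ + 1) ^ k) K j (Ac 0) Ac) *ᵥ Φ)) x)
        ≤ cH * supN Φ)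
    (P : ↥(Box d ℓ k Mb) → Prop) [DecidablePred P] {D : ℝ}
    (hD : ∀ x'', P x'' → ∃ ν, D ≤ |posR ℓ k Mb x ν - posR ℓ k Mb x'' ν|)
    (f : ↥(Box d ℓ k Mb) × ι → ℝ) (hfP : ∀ p, ¬ P p.1 → f p = 0) {φ : ℝ} (hφ : 0 ≤ φ) (hf : ∀ p, |f p| ≤ φ)
    (i0 : ι) :
    ((((ℓ + 1) ^ k : ℕ) : ℝ) / supNorm (x'.1 - x.1)) ^ α *
      |(transport (fieldLink F (e / ((ℓ + 1) ^ k : ℕ)) (fun u v : ↥(Box d ℓ k Mb) => compField Ac u.1 v.1)) x l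
          *ᵥ fld (derivA d F (e / ((ℓ + 1) ^ k : ℕ)) ℓ k Mb (fun u v : ↥(Box d ℓ k Mb) => compField Ac u.1 v.1) μ
                *ᵥ (greenA d F (e / ((ℓ + 1) ^ k : ℕ)) ℓ k a m2 Mb (baseEmb hn Mb) (stairContour hn Mb)
                    (fun u v : ↥(Box d ℓ k Mb) => compField Ac u.1 v.1) *ᵥ f)) x'
        - fld (derivA d F (e / ((ℓ + 1) ^ k : ℕ)) ℓ k Mb (fun u v : ↥(Box d ℓ k Mb) => compField Ac u.1 v.1) μ
                *ᵥ (greenA d F (e / ((ℓ + 1) ^ k : ℕ)) ℓ k a m2 Mb (baseEmb hn Mb) (stairContour hn Mb)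
                    (fun u v : ↥(Box d ℓ k Mb) => compField Ac u.1 v.1) *ᵥ f)) x) i0|
      ≤ 2 ^ (d + 4) * Real.exp (5 / 2)
          * (Real.sqrt (Fintype.card ι) * (cH + ((d : ℝ) + 1) * D1 hprof * cD
              + ((d : ℝ) + 3) * (((d : ℝ) + 1) * (D1 hprof + D2 hprof)) * cD
              + ((d : ℝ) + 1) * (D1 hprof ^ 2 + D2 hprof) * cG))
          * Real.exp (-(D / K)) * φ := by
  have hK1 : 1 ≤ K := le_trans (by norm_num) hK16
  exact thm19_holder_box F (e / ((ℓ + 1) ^ k : ℕ)) hℓ hk hn Mb hK16 h4 hKM ha hm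
    (fun u v : ↥(Box d ℓ k Mb) => compField Ac u.1 v.1)
    (fun j => cubeField (Box d ℓ k Mb) ((ℓ + 1) ^ k) K j (Ac 0) Ac)
    (fun j u v => cubeField_antisymm ((ℓ + 1) ^ k) K j (Ac 0) Ac u v)
    (fun j u v hu hv => cubeField_eq_compField hn hK1 j (Ac 0) Ac (fun ν => plateau_fine hu ν)
      (fun ν => plateau_fine hv ν))
    hcG hcD hcH hcK hG hDG hKG h3 μ x x' hxμ hx'μ hne hclose l hl hlend hlen hlnear hα0 hα1 hHG P hD f hfP hφ hf i0

end

end Literature.MathematicalPhysics.QuantumFieldTheory.Balaban1983to89.B4Thm19BoxHolderWalk
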